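import Summits.ResolutionOfSingularities.ResolutionOfSingularities.Theorems.FrobeniusLadderFRationalResolutionToricResolutionGeneral
import Mathlib.RingTheory.MvPolynomial.WeightedHomogeneous
import Mathlib.Algebra.MonoidAlgebra.MapDomain
import Mathlib.Algebra.DirectSum.Internal
import Mathlib.AlgebraicGeometry.Morphisms.Etale
import Mathlib.Data.Finsupp.Interval
import Mathlib.GroupTheory.OrderOfElement
import Mathlib.RingTheory.RegularLocalRing.Polynomial
import HarnessLib

/-!
# The diagonal bridge: every global diagonal quotient `𝔸ᴺ/D(A)` over every field is resolved

Support file for crux stmt-ResolutionOfSingularities-15317 (`FrobeniusLadder.FRationalResolution`), line `redirect`,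
brick (F) of the repair census for the endgame stub `stub_diagonalizableQuotientResolution` (resolution of
diagonalizable quotient singularities presented by étale charts `Spec S₀ → X`, `S` a finitely generated regular
`k`-algebra graded by a finite abelian group `A`, `S₀` its degree-`0` part).

The GLOBAL MODEL of such a chart is `S = k[x₁, …, x_N]` with the diagonal grading by weights `w : Fin N → A`
(`MvPolynomial.weightedGradedAlgebra`), i.e. the finite diagonalizable group scheme `D(A) = Spec k[A]` acting
linearly on `𝔸ᴺ`; then `S₀ = k[x]^{D(A)}` is the monoid algebra of the INVARIANT MONOID
`M = {d ∈ ℕᴺ : ∑ dᵢ wᵢ = 0} = ker (Finsupp.weight w)`. This file proves, on exponents and characteristic-free: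

* `weightZeroMonoid_fg` — `M` is finitely generated (by `n·eᵢ` and the box `{d ∈ M : d ≤ (n,…,n)}`, `n = |A|`);
* `weightZeroMonoid_algHom` — `k[M] ↪ k[x₁,…,x_N]` (push-forward along `M ⊆ ℕᴺ`) has range exactly the
  polynomials supported on weight-`0` monomials, whence `k[M] ≅ S₀` as `k`-algebras
  (`weightZeroMonoid_algEquiv_gradeZero`);
* `weightZeroMonoid_latticeForm` — `M ≅ Q ⊆ ℤᴺ` (`d ↦ (dᵢ)`), `Q` finitely generated and SATURATED in `ℤQ`;
* **`hasResolution_Spec_weightZeroMonoidAlgebra` / `hasResolution_diagonalQuotient`** — by the tree's resolution of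
  affine normal toric varieties over arbitrary fields (`hasResolution_Spec_addMonoidAlgebra_of_saturated`, which rests
  on the PROVED Kato (10.4)), `Spec k[M] ≅ Spec S₀ = 𝔸ᴺ/D(A)` HAS A RESOLUTION OF SINGULARITIES for every field `k`,
  every `N`, every finite abelian `A` and every weight vector `w` — tame and wild (`p ∣ |A|`) alike;
* `diagonalQuotient_stubInstance` — `X = 𝔸ᴺ/D(A)` satisfies the hypothesis `hq` of
  `stub_diagonalizableQuotientResolution` VERBATIM (chart = the isomorphism `Spec S₀ ≅ X`) together with its conclusion.

All folklore (Cox–Little–Schenck 2011 §1.3, §10.1; Fulton 1993 §2.2); no published fact is used as a hypothesis and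
no definition is introduced (the invariant monoid is the inline term `AddMonoidHom.mker (Finsupp.weight w)`).
-/

-- single-problem summit: the doubled namespace component is forced
set_option linter.dupNamespace false

noncomputable section

namespace Summit.ResolutionOfSingularities.ResolutionOfSingularities.Theorems.FRationalResolution

open CategoryTheory AlgebraicGeometry TopologicalSpace
open Literature.AlgebraicGeometry.Resolution

section DiagonalQuotient

variable (k : Type) [Field k] {N : ℕ} {A : Type} [AddCommGroup A]

/-- **The invariant monoid of a diagonal action is finitely generated.** For a finite abelian group `A` and weights
`w : Fin N → A`, the monoid `M = {d ∈ ℕᴺ : ∑ dᵢ • wᵢ = 0}` is generated by the finitely many elements `n·eᵢ`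
(`n = |A|`, so `n • wᵢ = 0`) and `{d ∈ M : dᵢ ≤ n ∀ i}`: write `d = (d mod n) + ∑ (dᵢ / n)·(n·eᵢ)`.
[folklore; CLS2011 §1.3] -/
theorem weightZeroMonoid_fg [Finite A] (w : Fin N → A) :
    (AddMonoidHom.mker (Finsupp.weight w : (Fin N →₀ ℕ) →+ A)).FG := by
  classical
  set M := AddMonoidHom.mker (Finsupp.weight w : (Fin N →₀ ℕ) →+ A) with hM
  set n : ℕ := Nat.card A with hn
  have hnw : ∀ a : A, n • a = 0 := fun a => card_nsmul_eq_zero'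
  have hwsingle : ∀ i : Fin N, Finsupp.weight w (Finsupp.single i n) = 0 := by
    intro i
    rw [Finsupp.weight_apply, Finsupp.sum_single_index (by simp)]
    exact hnw (w i)
  -- the finite generating set: `n·eᵢ` and the box of `M`
  let C : Fin N →₀ ℕ := Finsupp.equivFunOnFinite.symm fun _ => n
  let G : Set (Fin N →₀ ℕ) := (Set.range fun i : Fin N => Finsupp.single i n) ∪ (Set.Iic C ∩ ↑M)
  have hGfin : G.Finite := (Set.finite_range _).union ((Set.finite_Iic C).inter_of_left _)
  rw [AddSubmonoid.fg_iff]
  refine ⟨G, le_antisymm ?_ ?_, hGfin⟩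
  · rw [AddSubmonoid.closure_le]
    rintro d (⟨i, rfl⟩ | ⟨-, hd⟩)
    · change Finsupp.single i n ∈ M
      rw [hM, AddMonoidHom.mem_mker]
      exact hwsingle i
    · exact hd
  · intro d hd
    have hd0 : Finsupp.weight w d = 0 := by rwa [hM, AddMonoidHom.mem_mker] at hd
    -- `d = r + ∑ᵢ (dᵢ / n) • (n·eᵢ)` with `r = d mod n`
    let r : Fin N →₀ ℕ := Finsupp.equivFunOnFinite.symm fun i => d i % n
    have hr : ∀ i, r i = d i % n := fun i => rfl
    have hdecomp : d = r + ∑ i : Fin N, (d i / n) • Finsupp.single i n := by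
      ext j
      rw [Finsupp.add_apply, Finsupp.finsetSum_apply, hr,
        Finset.sum_eq_single j (fun i _ hij => by
            rw [Finsupp.smul_apply, Finsupp.single_apply, if_neg hij, smul_zero])
          (fun h => absurd (Finset.mem_univ j) h),
        Finsupp.smul_apply, Finsupp.single_eq_same, smul_eq_mul]
      exact (Nat.mod_add_div' (d j) n).symm
    have hrM : r ∈ M := by
      rw [hM, AddMonoidHom.mem_mker]
      have h := congrArg (Finsupp.weight w) hdecomp
      rw [map_add, map_sum] at h
      rw [hd0] at h
      have hsum : ∑ i : Fin N, Finsupp.weight w ((d i / n) • Finsupp.single i n) = 0 :=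
        Finset.sum_eq_zero fun i _ => by rw [map_nsmul, hwsingle, smul_zero]
      rw [hsum, add_zero] at h
      exact h.symm
    have hrC : r ∈ Set.Iic C := by
      change r ≤ C
      intro i
      change d i % n ≤ n
      exact (Nat.mod_lt _ Nat.card_pos).le
    rw [hdecomp]
    have hmemG : ∀ x ∈ G, x ∈ AddSubmonoid.closure G := fun x hx => AddSubmonoid.mem_closure_of_mem hx
    exact add_mem (hmemG r (Or.inr ⟨hrC, hrM⟩))
      (sum_mem fun i _ => nsmul_mem (hmemG _ (Or.inl ⟨i, rfl⟩)) _)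

/-- **`k[M] ↪ k[x₁,…,x_N]` with range the weight-`0` polynomials.** The push-forward of the inclusion
`M = ker (weight w) ⊆ ℕᴺ` is an injective `k`-algebra map `k[M] → k[x₁,…,x_N]` whose range is exactly the set of
polynomials all of whose monomials `xᵈ` have weight `∑ dᵢ • wᵢ = 0` (pull the coefficients back along the
inclusion). Valid for any additive commutative group (indeed monoid) of weights. [folklore; CLS2011 §1.3] -/
theorem weightZeroMonoid_algHom (w : Fin N → A) :
    ∃ ε : AddMonoidAlgebra k ↥(AddMonoidHom.mker (Finsupp.weight w : (Fin N →₀ ℕ) →+ A)) →ₐ[k]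
        MvPolynomial (Fin N) k, Function.Injective ε ∧
      ∀ f : MvPolynomial (Fin N) k, f ∈ Set.range ε ↔ ∀ d ∈ f.support, Finsupp.weight w d = 0 := by
  classical
  set M := AddMonoidHom.mker (Finsupp.weight w : (Fin N →₀ ℕ) →+ A) with hM
  have hval : Function.Injective (M.subtype : ↥M → (Fin N →₀ ℕ)) := Subtype.val_injective
  let ε : AddMonoidAlgebra k ↥M →ₐ[k] MvPolynomial (Fin N) k := AddMonoidAlgebra.mapDomainAlgHom k k M.subtype
  have hεapp : ∀ g, ε g = AddMonoidAlgebra.mapDomain M.subtype g := fun g => rfl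
  refine ⟨ε, fun g g' h => AddMonoidAlgebra.mapDomain_injective hval (by rwa [hεapp, hεapp] at h),
    fun f => ⟨?_, fun hf => ?_⟩⟩
  · rintro ⟨g, rfl⟩ d hd
    rw [← MvPolynomial.finsupp_support_eq_support, hεapp, AddMonoidAlgebra.coeff_mapDomain] at hd
    obtain ⟨m, -, rfl⟩ := Finset.mem_image.1 (Finsupp.mapDomain_support hd)
    exact AddMonoidHom.mem_mker.mp m.2
  · have hsupp : ↑(AddMonoidAlgebra.coeff f).support ⊆ Set.range (M.subtype : ↥M → (Fin N →₀ ℕ)) := by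
      intro d hd
      rw [Finset.mem_coe] at hd
      have hdM : d ∈ M := AddMonoidHom.mem_mker.mpr (hf d hd)
      exact ⟨⟨d, hdM⟩, rfl⟩
    exact ⟨AddMonoidAlgebra.comapDomain M.subtype hval f, by
      rw [hεapp]; exact AddMonoidAlgebra.mapDomain_comapDomain hsupp hval⟩

/-- **`k[M] ≅ S₀`**: the monoid algebra of the invariant monoid is the degree-`0` part of `k[x₁,…,x_N]` for the
diagonal grading by the weights `w` (`MvPolynomial.weightedGradedAlgebra`), as `k`-algebras.
[folklore; CLS2011 §1.3, §10.1] -/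
theorem weightZeroMonoid_algEquiv_gradeZero [DecidableEq A] (w : Fin N → A) :
    letI := MvPolynomial.weightedGradedAlgebra k w
    Nonempty (AddMonoidAlgebra k ↥(AddMonoidHom.mker (Finsupp.weight w : (Fin N →₀ ℕ) →+ A)) ≃ₐ[k]
      ↥(SetLike.GradeZero.subalgebra (MvPolynomial.weightedHomogeneousSubmodule k w))) := by
  letI := MvPolynomial.weightedGradedAlgebra k w
  obtain ⟨ε, hεinj, hεrange⟩ := weightZeroMonoid_algHom k w
  set B := SetLike.GradeZero.subalgebra (MvPolynomial.weightedHomogeneousSubmodule k w) with hB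
  have hmemB : ∀ f : MvPolynomial (Fin N) k, f ∈ B ↔ ∀ d ∈ f.support, Finsupp.weight w d = 0 := by
    intro f
    change f ∈ MvPolynomial.weightedHomogeneousSubmodule k w (0 : A) ↔ _
    rw [MvPolynomial.mem_weightedHomogeneousSubmodule]
    constructor
    · intro h d hd
      exact h (MvPolynomial.mem_support_iff.mp hd)
    · intro h d hd
      exact h d (MvPolynomial.mem_support_iff.mpr hd)
  have hεmem : ∀ t, ε t ∈ B := fun t => (hmemB _).mpr ((hεrange _).mp ⟨t, rfl⟩)
  let ε' : _ →ₐ[k] ↥B := ε.codRestrict B hεmem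
  refine ⟨AlgEquiv.ofBijective ε' ⟨fun t₁ t₂ h => hεinj (congrArg Subtype.val h), fun f => ?_⟩⟩
  obtain ⟨t, ht⟩ := (hεrange f.1).mpr ((hmemB f.1).mp f.2)
  exact ⟨t, Subtype.ext ht⟩

/-- **Lattice form of the invariant monoid.** For a finite abelian group `A` of weights, the invariant monoid
`M = ker (weight w) ⊆ ℕᴺ` is isomorphic (by `d ↦ (dᵢ) ∈ ℤᴺ`) to a finitely generated submonoid `Q ⊆ ℤᴺ` which is
SATURATED in the subgroup it spans (`v ∈ ℤQ`, `m v ∈ Q`, `m ≥ 1` `⇒ v ∈ Q`: nonnegativity divides out and the weight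
of `v` vanishes because the weight map extends additively to `ℤᴺ` and kills `ℤQ`), with `k[M] ≅ k[Q]`.
[folklore; CLS2011 §1.3] -/
theorem weightZeroMonoid_latticeForm [Finite A] (w : Fin N → A) :
    ∃ Q : AddSubmonoid (Fin N → ℤ), Q.FG ∧
      (∀ v ∈ Submodule.span ℤ (Q : Set (Fin N → ℤ)), ∀ m : ℕ, 0 < m → m • v ∈ Q → v ∈ Q) ∧
      Nonempty (AddMonoidAlgebra k ↥(AddMonoidHom.mker (Finsupp.weight w : (Fin N →₀ ℕ) →+ A)) ≃ₐ[k]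
        AddMonoidAlgebra k ↥Q) := by
  classical
  set M := AddMonoidHom.mker (Finsupp.weight w : (Fin N →₀ ℕ) →+ A) with hM
  -- the exponent embedding `ι : ℕᴺ ↪ ℤᴺ`
  let ι : (Fin N →₀ ℕ) →+ (Fin N → ℤ) :=
    { toFun := fun d i => ((d i : ℕ) : ℤ)
      map_zero' := by ext i; simp
      map_add' := fun d d' => by ext i; simp }
  have hι : ∀ d i, ι d i = ((d i : ℕ) : ℤ) := fun d i => rfl
  have hιinj : Function.Injective ι := by
    intro d d' h
    ext i
    have := congrFun h i
    rwa [hι, hι, Nat.cast_inj] at this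
  -- the additive extension of the weight to `ℤᴺ`
  let ψ : (Fin N → ℤ) →+ A :=
    { toFun := fun v => ∑ i, v i • w i
      map_zero' := by simp
      map_add' := fun v v' => by simp [add_smul, Finset.sum_add_distrib] }
  have hψ : ∀ v, ψ v = ∑ i, v i • w i := fun v => rfl
  have hψι : ∀ d, ψ (ι d) = Finsupp.weight w d := by
    intro d
    rw [hψ, Finsupp.weight_apply, Finsupp.sum_fintype _ _ (fun i => by simp)]
    refine Finset.sum_congr rfl fun i _ => ?_
    rw [hι, natCast_zsmul]
  set Q : AddSubmonoid (Fin N → ℤ) := M.map ι with hQ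
  have hmemQ : ∀ v, v ∈ Q ↔ (∀ i, 0 ≤ v i) ∧ ψ v = 0 := by
    intro v
    constructor
    · rintro ⟨d, hd, rfl⟩
      refine ⟨fun i => by rw [hι]; exact Int.natCast_nonneg _, ?_⟩
      rw [hψι]
      exact AddMonoidHom.mem_mker.mp hd
    · rintro ⟨hv, hv0⟩
      let d : Fin N →₀ ℕ := Finsupp.equivFunOnFinite.symm fun i => (v i).toNat
      have hd : ι d = v := by
        ext i
        rw [hι]
        exact Int.toNat_of_nonneg (hv i)
      refine ⟨d, ?_, hd⟩
      change d ∈ M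
      exact AddMonoidHom.mem_mker.mpr (by rw [← hψι, hd, hv0])
  refine ⟨Q, ?_, ?_, ?_⟩
  · exact AddSubmonoid.FG.map (weightZeroMonoid_fg w) ι
  · intro v hv m hm hmv
    rw [hmemQ] at hmv ⊢
    obtain ⟨hpos, hzero⟩ := hmv
    refine ⟨fun i => ?_, ?_⟩
    · have h := hpos i
      rw [Pi.smul_apply, nsmul_eq_mul] at h
      by_contra hlt
      exact absurd h (not_le.mpr (mul_neg_of_pos_of_neg (by exact_mod_cast hm) (not_le.mp hlt)))
    · -- `ψ` kills `Q`, hence its `ℤ`-span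
      have hker : ∀ u ∈ Submodule.span ℤ (Q : Set (Fin N → ℤ)), ψ u = 0 := by
        intro u hu
        refine Submodule.span_induction (p := fun u _ => ψ u = 0) ?_ ?_ ?_ ?_ hu
        · intro u hu
          exact ((hmemQ u).1 hu).2
        · exact map_zero ψ
        · intro u u' _ _ hu hu'
          rw [map_add, hu, hu', add_zero]
        · intro z u _ hu
          rw [map_zsmul, hu, smul_zero]
      exact hker v hv
  · exact ⟨AddMonoidAlgebra.domCongr k k (AddSubmonoid.equivMapOfInjective M ι hιinj)⟩

/-- **RESOLUTION OF `Spec k[M]` FOR THE INVARIANT MONOID OF ANY DIAGONAL ACTION**: for every field `k`, every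
`N`, every finite abelian group `A` and every weight vector `w : Fin N → A`, the spectrum of the monoid algebra of
`M = {d ∈ ℕᴺ : ∑ dᵢ • wᵢ = 0}` has a resolution of singularities (lattice form + the tree's resolution of
`Spec k[Q]` for fine saturated `Q ⊆ ℤᴺ`, `hasResolution_Spec_addMonoidAlgebra_of_saturated`, over PROVED Kato (10.4)).
[folklore + Kato1994 (10.4)] -/
theorem hasResolution_Spec_weightZeroMonoidAlgebra [Finite A] (w : Fin N → A) :
    Scheme.HasResolution
      (Spec (.of (AddMonoidAlgebra k ↥(AddMonoidHom.mker (Finsupp.weight w : (Fin N →₀ ℕ) →+ A))))) := by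
  obtain ⟨Q, hQfg, hsat, ⟨e⟩⟩ := weightZeroMonoid_latticeForm k w
  have hres : Scheme.HasResolution (Spec (.of (AddMonoidAlgebra k ↥Q))) :=
    hasResolution_Spec_addMonoidAlgebra_of_saturated k Q hQfg hsat
  exact Scheme.HasResolution.of_iso (Spec.map e.toRingEquiv.toCommRingCatIso.hom) hres

/-- **EVERY GLOBAL DIAGONAL QUOTIENT `𝔸ᴺ/D(A)` OVER EVERY FIELD HAS A RESOLUTION OF SINGULARITIES.** For a field
`k`, a finite abelian group `A` and weights `w : Fin N → A`, the spectrum of the degree-`0` part `S₀` of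
`S = k[x₁,…,x_N]` with the diagonal grading (`MvPolynomial.weightedGradedAlgebra`; `S₀ = k[x]^{D(A)}`, the quotient of
`𝔸ᴺ` by the finite diagonalizable group scheme `D(A) = Spec k[A]` acting with characters `wᵢ`, tame or wild) has a
resolution of singularities. This is the conclusion of `stub_diagonalizableQuotientResolution` for its global linear
models, in all dimensions and characteristics. [folklore + Kato1994 (10.4)] -/
theorem hasResolution_diagonalQuotient [Finite A] [DecidableEq A] (w : Fin N → A) :
    letI := MvPolynomial.weightedGradedAlgebra k w
    Scheme.HasResolution
      (Spec (.of ↥(SetLike.GradeZero.subalgebra (MvPolynomial.weightedHomogeneousSubmodule k w)))) := by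
  letI := MvPolynomial.weightedGradedAlgebra k w
  obtain ⟨e⟩ := weightZeroMonoid_algEquiv_gradeZero k w
  exact Scheme.HasResolution.of_iso (Spec.map e.toRingEquiv.toCommRingCatIso.inv)
    (hasResolution_Spec_weightZeroMonoidAlgebra k w)

/-- The same, with the degree-`0` part written as the stub writes it (`𝒮 0` with `SetLike.GradeZero.instCommRing`).
[folklore + Kato1994 (10.4)] -/
theorem hasResolution_diagonalQuotient' [Finite A] [DecidableEq A] (w : Fin N → A) :
    letI := MvPolynomial.weightedGradedAlgebra k w
    Scheme.HasResolution (Spec (.of ↥(MvPolynomial.weightedHomogeneousSubmodule k w 0))) :=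
  hasResolution_diagonalQuotient k w

/-- **THE GLOBAL DIAGONAL QUOTIENTS ARE INSTANCES OF THE ENDGAME STUB, WITH ITS CONCLUSION**: for every field `k`,
finite abelian `A` and weights `w : Fin N → A`, the `k`-scheme `X = Spec k[M] ≅ 𝔸ᴺ/D(A)` satisfies the hypothesis
`hq` of `stub_diagonalizableQuotientResolution` VERBATIM — every point lies in the image of an étale `k`-morphism
(indeed an isomorphism) from `Spec` of the degree-`0` part of the finitely generated regular graded `k`-algebra
`k[x₁,…,x_N]` — AND its conclusion `Scheme.HasResolution X`, unconditionally. [folklore + Kato1994 (10.4)] -/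
theorem diagonalQuotient_stubInstance [Finite A] [DecidableEq A] (w : Fin N → A) :
    (∀ z : Spec (.of (AddMonoidAlgebra k ↥(AddMonoidHom.mker (Finsupp.weight w : (Fin N →₀ ℕ) →+ A)))),
      ∃ (A' : Type) (_ : AddCommGroup A') (_ : Finite A') (_ : DecidableEq A')
        (S : Type) (_ : CommRing S) (_ : Algebra k S) (𝒮 : A' → Submodule k S)
        (_ : GradedAlgebra 𝒮), Algebra.FiniteType k S ∧ IsRegularRing S ∧
        ∃ φ : Spec (.of (𝒮 0)) ⟶
            Spec (.of (AddMonoidAlgebra k ↥(AddMonoidHom.mker (Finsupp.weight w : (Fin N →₀ ℕ) →+ A)))),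
          Etale φ ∧ z ∈ Set.range φ ∧
          φ ≫ Spec.map (CommRingCat.ofHom (algebraMap k
              (AddMonoidAlgebra k ↥(AddMonoidHom.mker (Finsupp.weight w : (Fin N →₀ ℕ) →+ A))))) =
            Spec.map (CommRingCat.ofHom (algebraMap k (𝒮 0)))) ∧
    Scheme.HasResolution
      (Spec (.of (AddMonoidAlgebra k ↥(AddMonoidHom.mker (Finsupp.weight w : (Fin N →₀ ℕ) →+ A))))) := by
  letI := MvPolynomial.weightedGradedAlgebra k w
  refine ⟨fun z => ?_, hasResolution_Spec_weightZeroMonoidAlgebra k w⟩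
  obtain ⟨e⟩ := weightZeroMonoid_algEquiv_gradeZero k w
  refine ⟨A, inferInstance, inferInstance, inferInstance, MvPolynomial (Fin N) k, inferInstance, inferInstance,
    MvPolynomial.weightedHomogeneousSubmodule k w, MvPolynomial.weightedGradedAlgebra k w,
    inferInstance, inferInstance, ?_⟩
  let ι : CommRingCat.of (AddMonoidAlgebra k ↥(AddMonoidHom.mker (Finsupp.weight w : (Fin N →₀ ℕ) →+ A))) ≅
      CommRingCat.of ↥(SetLike.GradeZero.subalgebra (MvPolynomial.weightedHomogeneousSubmodule k w)) :=
    e.toRingEquiv.toCommRingCatIso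
  refine ⟨Spec.map ι.hom, inferInstance, ?_, ?_⟩
  · exact (inferInstance : Surjective (Spec.map ι.hom)).1 z |>.imp fun _ h => h
  · rw [← Spec.map_comp]
    congr 1
    ext c : 2
    exact e.commutes c

end DiagonalQuotient

end Summit.ResolutionOfSingularities.ResolutionOfSingularities.Theorems.FRationalResolution

end
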